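import Literature.NumberTheory.EllipticCurves.RootNumberLocalConstancyResidualProofs
import HarnessLib

/-!
# Helfgott's locally constant local tables: the semistable places above `2` and `3`

A third `…Proofs` sibling (theorems only: no definition, no named fact, no instance) of
`Literature.NumberTheory.EllipticCurves.RootNumberLocalConstancy`, written by the `provefact` seat of
the named fact
`Literature.NumberTheory.EllipticCurves.Helfgott2004_exists_local_tables_locallyConstant`
(Helfgott 2004, §4). The sibling `RootNumberLocalConstancyResidualProofs` reduced the named fact to
{Modularity, Kellock–Dokchitser Rem. 2.2 above `p ≥ 5`, the `p`-adic local constancy of the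
Atkin–Lehner sign `[p ∣ N_W ? λ(Q_p)(f_W) : 1]` around every `p`-integral elliptic equation over
`ℚ_p`, `p = 2, 3`} (`Helfgott2004_exists_local_tables_locallyConstant_of_residual`). This file proves
the last input at the equations whose minimal model is **semistable** (good or multiplicative
reduction), in every residue characteristic — the trivial branches of Helfgott's Lemma 4.4 and the
first half of the last paragraph of the proof of his Prop. 4.3 (PDF p. 11: the nearby tuples "will
have (a) split multiplicative reduction, (b) unsplit multiplicative reduction or (c) additive,
potentially multiplicative reduction depending on whether (a) `v(c₄) = 0` and the reduction of
`a₁, …, a₆` describes a singular cubic with a split node, (b) `v(c₄) = 0` and … an unsplit node,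
(c) `v(c₄) > 0`. Thus, the reduction type is constant in the neighbourhood … When an elliptic curve
has multiplicative reduction, the root number depends only on whether the reduction is split or
unsplit"), read through Kellock–Dokchitser 2023, Thm. 2.3 (ii)–(iv)
(`w = 1` at good reduction, `w = −a_p = λ(Q_p)` at multiplicative reduction, Knapp 1993,
Thm. 9.27) — so that only the equations with **additive** reduction above `2, 3` remain:

* `WeierstrassCurve.localRootNumber_locallyConstant_of_not_hasAdditiveReduction` — over any discrete
  valuation ring `R` (no hypothesis on `2, 3`): near an `R`-integral equation with `Δ ≠ 0` and
  semistable minimal model, the minimal models of all equations have the same reduction type (good /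
  multiplicative / split multiplicative, never additive) and the same Rohrlich `localRootNumber`.
  Same architecture as `localRootNumber_locallyConstant_of_isUnit` (file
  `RootNumberLocalConstancyProofs`; Silverman AEC VII.1 Prop. 1.3 (b), (d)), the minimality of the
  transformed nearby equation now coming from `v(Δ) = 0` or `v(c₄) = 0`
  (`isMinimal_of_not_Δ_mem_pow_and_c₄_mem_pow`, valid in all characteristics).
* `atkinLehnerSign_locallyConstant_of_not_hasAdditiveReduction` — over `ℚ_v`, any `v`: the
  Atkin–Lehner sign of rational elliptic curves is locally constant near such an equation
  (`p ∣ N ↔` bad, `p² ∣ N ↔` additive, `λ(Q_p) = w_p` at `p ∥ N`: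
  `natGenerator_dvd_conductorNorm_iff`, `natGenerator_sq_dvd_conductorNorm_iff`,
  `atkinLehnerEigenvalueAt_eq_localRootNumberAt_of_not_sq_dvd`).
* `Helfgott2004_exists_local_tables_locallyConstant_of_residual_additive` — the named fact from
  {Modularity (`exists_isNewformOf`), Kellock–Dokchitser Rem. 2.2 above `p ≥ 5`
  (`WeierstrassCurve.atkinLehnerEigenvalueAt_eq_localRootNumberAt`), `p`-adic local constancy of the
  Atkin–Lehner sign around the `p`-integral elliptic equations over `ℚ_p` **with additive reduction**,
  `p = 2, 3`} — the last being Helfgott's Prop. 4.2 (potentially good reduction: Tate modules of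
  `p`-adically close curves, Deligne's local constants) and the second half of the last paragraph of
  the proof of Prop. 4.3 (additive potentially multiplicative reduction: "`W` depends only on `K`
  and on the class of `−c₆` in `K*/K*²`", Rohrlich) at `K = ℚ₂, ℚ₃`, with local–global
  compatibility (`W(E/ℚ_p) = λ(Q_p)(f_E)`, Kellock–Dokchitser Rem. 2.2); and
  `exists_local_tables_two_three_of_locallyConstant_residual_additive`, the same for the weaker
  `exists_local_tables_two_three`. This matches the granularity of
  `exists_local_tables_two_three_of_residual` (residual input at the *additive* places above `2, 3`).

## References

* [Helfgott2004RootNumberFamilies] H. A. Helfgott, *On the behaviour of root numbers in families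
  of elliptic curves*, arXiv:math/0408141 (2004), §4: Prop. 4.2, Prop. 4.3 (proof, last
  paragraph), Lemma 4.4 (held copy `paper:arxiv-math_0408141`, PDF pp. 10–11).
* [KellockDokchitser2023] L. Cowland Kellock, V. Dokchitser, *Root numbers and parity phenomena*,
  Bull. Lond. Math. Soc. 55 (2023), Rem. 2.2, Thm. 2.3 (PDF pp. 7–8 of `paper:arxiv-2303.07883`).
* [Knapp1993] A. W. Knapp, *Elliptic curves*, Math. Notes 40 (1993), Thm. 9.27.
* [SilvermanAEC2009] J. H. Silverman, *The Arithmetic of Elliptic Curves*, GTM 106, 2nd ed. 2009,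
  VII.1 Prop. 1.3 and Remark 1.1, VII.5 Prop. 5.1.
* [Rohrlich1993Compositio] D. Rohrlich, Compositio Math. 87 (1993), Prop. 2.
-/

noncomputable section

open scoped Classical MatrixGroups

open IsDedekindDomain IsDiscreteValuationRing IsDedekindDomain.HeightOneSpectrum

namespace WeierstrassCurve

section DVR

variable (R : Type*) [CommRing R] [IsDomain R] [IsDiscreteValuationRing R]
  {K : Type*} [Field K] [Algebra R K] [IsFractionRing R K]

/-- **Local constancy of the reduction type and of Rohrlich's local root number near a semistable
equation, in every residue characteristic** (Helfgott 2004, §4: the trivial branches of Lemma 4.4 —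
good reduction, `W = 1`; multiplicative reduction, `W = ∓1` according as the node is split or not —
and the first half of the last paragraph of the proof of Prop. 4.3, PDF p. 11: nearby minimal
tuples have split / unsplit multiplicative reduction "depending on whether (a) `v(c₄) = 0` and the
reduction of `a₁, …, a₆` describes a singular cubic with a split node, (b) `v(c₄) = 0` and … an
unsplit node … Thus, the reduction type is constant in the neighbourhood … When an elliptic curve
has multiplicative reduction, the root number depends only on whether the reduction is split or
unsplit"). Let `W₁` be `R`-integral with `Δ ≠ 0` whose minimal
model is not additive (good or multiplicative reduction). Then every `W₂` whose coefficients are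
close to those of `W₁` has a minimal model of the same type (good, multiplicative, split
multiplicative; never additive) and the same `localRootNumber`. Proof: the minimising change of
variables `D` of `W₁` is `R`-integral (AEC VII.1.3(d)); `D • W₂ ≡ D • W₁ (mod 𝔪ᴺ)` with the same
`v(Δ)` and — when `c₄(D • W₁) ≠ 0` — the same `v(c₄)`, and the same reduction; it is minimal
because `v(Δ) = 0` or `v(c₄) = 0` (criterion valid in all characteristics,
`isMinimal_of_not_Δ_mem_pow_and_c₄_mem_pow`); the chosen minimal model of `W₂` carries the same
data (AEC VII.1.3(b)). No hypothesis on `2, 3`.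
[cite: Helfgott2004RootNumberFamilies, §4 proof of Prop. 4.3 (last paragraph) and Lemma 4.4]
[cite: SilvermanAEC2009, VII.1 Prop. 1.3 and Remark 1.1] -/
theorem localRootNumber_locallyConstant_of_not_hasAdditiveReduction (W₁ : WeierstrassCurve K)
    [IsIntegral R W₁] (hΔ₁ : W₁.Δ ≠ 0) (hadd : ¬ (W₁.minimal R).HasAdditiveReduction R) :
    ∃ z : K, z ≠ 0 ∧ ∀ W₂ : WeierstrassCurve K,
      valuation K (maximalIdeal R) (W₂.a₁ - W₁.a₁) < valuation K (maximalIdeal R) z →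
      valuation K (maximalIdeal R) (W₂.a₂ - W₁.a₂) < valuation K (maximalIdeal R) z →
      valuation K (maximalIdeal R) (W₂.a₃ - W₁.a₃) < valuation K (maximalIdeal R) z →
      valuation K (maximalIdeal R) (W₂.a₄ - W₁.a₄) < valuation K (maximalIdeal R) z →
      valuation K (maximalIdeal R) (W₂.a₆ - W₁.a₆) < valuation K (maximalIdeal R) z →
      ((W₂.minimal R).HasGoodReduction R ↔ (W₁.minimal R).HasGoodReduction R) ∧
      ((W₂.minimal R).HasMultiplicativeReduction R ↔ (W₁.minimal R).HasMultiplicativeReduction R) ∧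
      ((W₂.minimal R).HasSplitMultiplicativeReduction R ↔
        (W₁.minimal R).HasSplitMultiplicativeReduction R) ∧
      ¬ (W₂.minimal R).HasAdditiveReduction R ∧
      W₂.localRootNumber R = W₁.localRootNumber R := by
  -- the chosen minimal model `X₁ = D • W₁` of `W₁`
  obtain ⟨D, hD⟩ : ∃ D : VariableChange K, W₁.minimal R = D • W₁ := ⟨_, rfl⟩
  set X₁ := W₁.minimal R with hX₁
  haveI hX₁min : IsMinimal R X₁ := by rw [hX₁]; infer_instance
  haveI hDmin : IsMinimal R (D • W₁) := hD ▸ hX₁min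
  have hX₁Δ : X₁.Δ ≠ 0 := by
    rw [hD, variableChange_Δ]; exact mul_ne_zero (pow_ne_zero _ (Units.ne_zero _)) hΔ₁
  -- `u, r, s, t ∈ R` (Silverman, AEC VII.1.3(d))
  have hu : valuation K (maximalIdeal R) (D.u : K) ≤ 1 :=
    valuation_u_le_one_of_isMinimal_smul R W₁ D hΔ₁
  obtain ⟨⟨r, hr⟩, ⟨s, hs⟩, ⟨t, ht⟩⟩ := exists_lift_variableChange_of_isIntegral R W₁ D hu
  have hr' : valuation K (maximalIdeal R) D.r ≤ 1 := hr ▸ valuation_le_one _ r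
  have hs' : valuation K (maximalIdeal R) D.s ≤ 1 := hs ▸ valuation_le_one _ s
  have ht' : valuation K (maximalIdeal R) D.t ≤ 1 := ht ▸ valuation_le_one _ t
  -- `X₁` is not additive: `v (Δ (X₁)) = 1` or `v (c₄ (X₁)) = 1`
  have hiΔ : valuation K (maximalIdeal R) X₁.Δ ≤ 1 := by
    rw [← integralModel_Δ_eq R X₁]; exact valuation_le_one _ _
  have hic₄ : valuation K (maximalIdeal R) X₁.c₄ ≤ 1 := by
    rw [← integralModel_c₄_eq R X₁]; exact valuation_le_one _ _
  have hX₁na : valuation K (maximalIdeal R) X₁.Δ = 1 ∨ valuation K (maximalIdeal R) X₁.c₄ = 1 := by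
    by_contra h
    rw [not_or] at h
    exact hadd ((hasAdditiveReduction_iff R X₁).2 ⟨hX₁min, lt_of_le_of_ne hiΔ h.1,
      lt_of_le_of_ne hic₄ h.2⟩)
  -- the modulus `N`: `exp (-N) < v (Δ (X₁))`, and `exp (-N) < v (c₄ (X₁))` unless `c₄ (X₁) = 0`
  have hνΔ₁ : valuation K (maximalIdeal R) X₁.Δ ≠ 0 := (Valuation.ne_zero_iff _).2 hX₁Δ
  obtain ⟨N₁, hN₁⟩ := WithZero.exists_exp_neg_natCast_lt hνΔ₁
  obtain ⟨N₂, hN₂⟩ : ∃ N₂ : ℕ, X₁.c₄ ≠ 0 →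
      WithZero.exp (-(N₂ : ℤ)) < valuation K (maximalIdeal R) X₁.c₄ := by
    by_cases hc : X₁.c₄ = 0
    · exact ⟨0, fun h ↦ absurd hc h⟩
    · obtain ⟨N₂, hN₂⟩ := WithZero.exists_exp_neg_natCast_lt ((Valuation.ne_zero_iff _).2 hc)
      exact ⟨N₂, fun _ ↦ hN₂⟩
  set N := max N₁ N₂ with hN
  have hNΔ : WithZero.exp (-(N : ℤ)) < valuation K (maximalIdeal R) X₁.Δ :=
    lt_of_le_of_lt (WithZero.exp_le_exp.2 (by omega)) hN₁
  have hNc₄ : X₁.c₄ ≠ 0 → WithZero.exp (-(N : ℤ)) < valuation K (maximalIdeal R) X₁.c₄ :=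
    fun h ↦ lt_of_le_of_lt (WithZero.exp_le_exp.2 (by omega)) (hN₂ h)
  have hN0 : WithZero.exp (-(N : ℤ)) < (1 : WithZero (Multiplicative ℤ)) := lt_of_lt_of_le hNΔ hiΔ
  -- a uniformiser and the threshold `z = u⁶ πᴺ`
  obtain ⟨π, hπ⟩ := valuation_exists_uniformizer K (maximalIdeal R)
  have hπN : valuation K (maximalIdeal R) (π ^ N) = WithZero.exp (-(N : ℤ)) := by
    rw [map_pow, hπ, ← WithZero.exp_nsmul]; simp
  have hπ0 : π ≠ 0 := by
    intro h0; rw [h0, map_zero] at hπ; exact WithZero.exp_ne_zero hπ.symm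
  refine ⟨(D.u : K) ^ 6 * π ^ N, mul_ne_zero (pow_ne_zero _ D.u.ne_zero) (pow_ne_zero _ hπ0),
    fun W₂ h₁ h₂ h₃ h₄ h₆ ↦ ?_⟩
  rw [map_mul, map_pow, hπN] at h₁ h₂ h₃ h₄ h₆
  -- the same change of variables applied to `W₂`: `X₂ = D • W₂ ≡ X₁ (mod 𝔪ᴺ)`
  obtain ⟨k₁, k₂, k₃, k₄, k₆⟩ :=
    valuation_variableChange_sub_lt (valuation K (maximalIdeal R)) hu hr' hs' ht' h₁ h₂ h₃ h₄ h₆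
  rw [← hD] at k₁ k₂ k₃ k₄ k₆
  set X₂ := D • W₂ with hX₂
  haveI hX₂int : IsIntegral R X₂ :=
    isIntegral_of_valuation_sub_le_one R (k₁.trans hN0).le (k₂.trans hN0).le (k₃.trans hN0).le
      (k₄.trans hN0).le (k₆.trans hN0).le
  obtain ⟨hΔsub, hc₄sub⟩ := valuation_Δ_sub_le_and_c₄_sub_le R k₁.le k₂.le k₃.le k₄.le k₆.le
  have hνΔ : valuation K (maximalIdeal R) X₂.Δ = valuation K (maximalIdeal R) X₁.Δ :=
    Valuation.map_eq_of_sub_lt _ (hΔsub.trans_lt hNΔ)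
  have hνc₄ : X₁.c₄ ≠ 0 →
      valuation K (maximalIdeal R) X₂.c₄ = valuation K (maximalIdeal R) X₁.c₄ := fun hc ↦
    Valuation.map_eq_of_sub_lt _ (hc₄sub.trans_lt (hNc₄ hc))
  have hX₂Δ : X₂.Δ ≠ 0 := (Valuation.ne_zero_iff _).1 (hνΔ ▸ hνΔ₁)
  have hred := map_integralModel_eq_of_valuation_sub_lt_one R (k₁.trans hN0) (k₂.trans hN0)
    (k₃.trans hN0) (k₄.trans hN0) (k₆.trans hN0)
  have h12 : WithZero.exp (-((12 : ℕ) : ℤ)) < (1 : WithZero (Multiplicative ℤ)) := by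
    rw [← WithZero.exp_zero]; exact WithZero.exp_lt_exp.2 (by norm_num)
  have h4 : WithZero.exp (-((4 : ℕ) : ℤ)) < (1 : WithZero (Multiplicative ℤ)) := by
    rw [← WithZero.exp_zero]; exact WithZero.exp_lt_exp.2 (by norm_num)
  -- `X₂` is minimal: `v (Δ (X₂)) = 1` or `v (c₄ (X₂)) = 1` (criterion valid in all characteristics)
  haveI hX₂min : IsMinimal R X₂ := by
    refine isMinimal_of_not_Δ_mem_pow_and_c₄_mem_pow R X₂ ?_
    rintro ⟨hΔ12, hc₄4⟩
    rcases hX₁na with h | h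
    · rw [← valuation_maximalIdeal_algebraMap_le_exp_neg_iff R (K := K), integralModel_Δ_eq, hνΔ,
        h] at hΔ12
      exact absurd hΔ12 (not_le.2 h12)
    · have hc : X₁.c₄ ≠ 0 := fun h0 ↦ by rw [h0, map_zero] at h; exact zero_ne_one h
      rw [← valuation_maximalIdeal_algebraMap_le_exp_neg_iff R (K := K), integralModel_c₄_eq,
        hνc₄ hc, h] at hc₄4
      exact absurd hc₄4 (not_le.2 h4)
  -- the chosen minimal model of `W₂` versus `X₂` (AEC VII.1.3(b))
  obtain ⟨D₂, hD₂⟩ : ∃ D' : VariableChange K, W₂.minimal R = D' • W₂ := ⟨_, rfl⟩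
  have hrel : W₂.minimal R = (D₂ * D⁻¹) • X₂ := by rw [hD₂, hX₂, mul_smul, inv_smul_smul]
  have tg := hasGoodReduction_iff_of_isMinimal_of_eq_smul R hrel
  have tm := hasMultiplicativeReduction_iff_of_isMinimal_of_eq_smul R hrel hX₂Δ
  have ts := hasSplitMultiplicativeReduction_iff_of_isMinimal_of_eq_smul R hrel hX₂Δ
  have ta := hasAdditiveReduction_iff_of_isMinimal_of_eq_smul R hrel hX₂Δ
  -- `X₂` versus `X₁` (congruence modulo `𝔪ᴺ`)
  have sg : X₂.HasGoodReduction R ↔ X₁.HasGoodReduction R := by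
    rw [hasGoodReduction_iff, hasGoodReduction_iff, hνΔ]
    exact and_congr_left' ⟨fun _ ↦ hX₁min, fun _ ↦ hX₂min⟩
  have sP := map_nodalTangents_eq_of_map_eq R (algebraMap R (IsLocalRing.ResidueField R)) hred
  have sm : X₂.HasMultiplicativeReduction R ↔ X₁.HasMultiplicativeReduction R := by
    by_cases hc : X₁.c₄ = 0
    · -- `c₄ (X₁) = 0`: `X₁` is not multiplicative, hence good; so is `X₂`
      have hm₁ : ¬ X₁.HasMultiplicativeReduction R := fun h ↦ by
        have h1 := h.multiplicativeReduction
        rw [hc, map_zero] at h1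
        exact zero_ne_one h1
      have hg₁ : valuation K (maximalIdeal R) X₁.Δ = 1 := by
        rcases hX₁na with h | h
        · exact h
        · rw [hc, map_zero] at h; exact absurd h zero_ne_one
      have hm₂ : ¬ X₂.HasMultiplicativeReduction R := fun h ↦ by
        have h1 := ((hasMultiplicativeReduction_iff R X₂).1 h).2.1
        rw [hνΔ, hg₁] at h1
        exact lt_irrefl _ h1
      exact ⟨fun h ↦ absurd h hm₂, fun h ↦ absurd h hm₁⟩
    · rw [hasMultiplicativeReduction_iff, hasMultiplicativeReduction_iff, hνΔ, hνc₄ hc]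
      exact and_congr_left' ⟨fun _ ↦ hX₁min, fun _ ↦ hX₂min⟩
  have ss : X₂.HasSplitMultiplicativeReduction R ↔ X₁.HasSplitMultiplicativeReduction R := by
    rw [hasSplitMultiplicativeReduction_iff, hasSplitMultiplicativeReduction_iff]
    exact ⟨fun ⟨h₁, h₂⟩ ↦ ⟨sm.mp h₁, by simpa only [sP] using h₂⟩,
      fun ⟨h₁, h₂⟩ ↦ ⟨sm.mpr h₁, by simpa only [sP] using h₂⟩⟩
  have sa : ¬ X₂.HasAdditiveReduction R := fun h ↦ by
    obtain ⟨-, hΔlt, hc₄lt⟩ := (hasAdditiveReduction_iff R X₂).1 h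
    rcases hX₁na with h' | h'
    · rw [hνΔ, h'] at hΔlt; exact lt_irrefl _ hΔlt
    · have hc : X₁.c₄ ≠ 0 := fun h0 ↦ by rw [h0, map_zero] at h'; exact zero_ne_one h'
      rw [hνc₄ hc, h'] at hc₄lt; exact lt_irrefl _ hc₄lt
  -- good or multiplicative, on both sides
  have hgm₁ : X₁.HasGoodReduction R ∨ X₁.HasMultiplicativeReduction R := by
    rcases hX₁na with h | h
    · exact Or.inl ((hasGoodReduction_iff R X₁).2 ⟨hX₁min, h⟩)
    · by_cases hg : valuation K (maximalIdeal R) X₁.Δ = 1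
      · exact Or.inl ((hasGoodReduction_iff R X₁).2 ⟨hX₁min, hg⟩)
      · exact Or.inr ((hasMultiplicativeReduction_iff R X₁).2 ⟨hX₁min, lt_of_le_of_ne hiΔ hg, h⟩)
  refine ⟨tg.trans sg, tm.trans sm, ts.trans ss, fun h ↦ sa (ta.1 h), ?_⟩
  -- the local root number: only the first three branches of the case list are reached
  have tg' : (W₂.minimal R).HasGoodReduction R ↔ X₁.HasGoodReduction R := tg.trans sg
  have tm' : (W₂.minimal R).HasMultiplicativeReduction R ↔ X₁.HasMultiplicativeReduction R :=
    tm.trans sm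
  have ts' : (W₂.minimal R).HasSplitMultiplicativeReduction R ↔
      X₁.HasSplitMultiplicativeReduction R := ts.trans ss
  rcases hgm₁ with hg | hm
  · simp only [localRootNumber, ← hX₁, tg', hg, if_true]
  · have hng : ¬ X₁.HasGoodReduction R := fun hg ↦ by
      have h1 := ((hasGoodReduction_iff R X₁).1 hg).2
      have h2 := ((hasMultiplicativeReduction_iff R X₁).1 hm).2.1
      rw [h1] at h2; exact lt_irrefl _ h2
    simp only [localRootNumber, ← hX₁, tg', tm', ts', hng, hm, if_false, if_true]

end DVR

end WeierstrassCurve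

/-! ### Over `ℚ_v`: the Atkin–Lehner sign is locally constant near a semistable equation -/

namespace Literature.NumberTheory.EllipticCurves

open WeierstrassCurve CongruenceSubgroup Literature.NumberTheory.EllipticCurves.ModularForms
  Rat.HeightOneSpectrum

/-- **The `v`-adic local constancy of the Atkin–Lehner sign near a semistable `v`-integral
equation, any residue characteristic** (the trivial branches of Helfgott 2004, Lemma 4.4, read
through Kellock–Dokchitser 2023, Rem. 2.2 / Thm. 2.3 (ii)–(iv): `W = 1` at good reduction,
`W = −a_p = λ(Q_p)` at multiplicative reduction). Let `X` be an elliptic equation over `ℚ_v` with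
coefficients in `O_v` whose minimal model has good or multiplicative reduction. Then there is `n`
such that for all elliptic `W₁, W₂ / ℚ` with newforms `f₁, f₂` whose coefficients are within
`exp(−n)` of those of `X`: `[p ∣ N₁ ? λ(Q_p)(f₁) : 1] = [p ∣ N₂ ? λ(Q_p)(f₂) : 1]`. Indeed both
`Wᵢ ×_ℚ ℚ_v` then have the reduction type of `X` and Rohrlich's local root number of `X`
(`WeierstrassCurve.localRootNumber_locallyConstant_of_not_hasAdditiveReduction`), so `p ∣ Nᵢ ↔`
bad reduction (`natGenerator_dvd_conductorNorm_iff`), `p² ∤ Nᵢ`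
(`natGenerator_sq_dvd_conductorNorm_iff`), and at `p ∥ Nᵢ` the sign is `w_p(Eᵢ)`
(`atkinLehnerEigenvalueAt_eq_localRootNumberAt_of_not_sq_dvd`, Knapp 1993, Thm. 9.27). Hence the
hypothesis `hlc` of `Helfgott2004_exists_local_tables_locallyConstant_of_residual` is needed only at
the equations with *additive* reduction above `2, 3`.
[cite: Helfgott2004RootNumberFamilies, §4 Lemma 4.4 and proof of Prop. 4.3]
[cite: KellockDokchitser2023, Rem. 2.2 and Thm. 2.3 (ii)–(iv)] [cite: Knapp1993, Thm. 9.27] -/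
theorem atkinLehnerSign_locallyConstant_of_not_hasAdditiveReduction {v : HeightOneSpectrum ℤ}
    (X : WeierstrassCurve (v.adicCompletion ℚ)) (hX : X.IsElliptic)
    (h₁ : X.a₁ ∈ v.adicCompletionIntegers ℚ) (h₂ : X.a₂ ∈ v.adicCompletionIntegers ℚ)
    (h₃ : X.a₃ ∈ v.adicCompletionIntegers ℚ) (h₄ : X.a₄ ∈ v.adicCompletionIntegers ℚ)
    (h₆ : X.a₆ ∈ v.adicCompletionIntegers ℚ)
    (hadd : ¬ (X.minimal (v.adicCompletionIntegers ℚ)).HasAdditiveReduction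
      (v.adicCompletionIntegers ℚ)) :
    ∃ n : ℕ, ∀ (W₁ W₂ : WeierstrassCurve ℚ) [W₁.IsElliptic] [W₂.IsElliptic]
      [NeZero (W₁.conductorNorm ℤ)] [NeZero (W₂.conductorNorm ℤ)]
      (f₁ : CuspForm (Gamma0 (W₁.conductorNorm ℤ)) 2)
      (f₂ : CuspForm (Gamma0 (W₂.conductorNorm ℤ)) 2), IsNewformOf W₁ f₁ → IsNewformOf W₂ f₂ →
      Valued.v ((W₁.baseChange (v.adicCompletion ℚ)).a₁ - X.a₁) < WithZero.exp (-(n : ℤ)) →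
      Valued.v ((W₁.baseChange (v.adicCompletion ℚ)).a₂ - X.a₂) < WithZero.exp (-(n : ℤ)) →
      Valued.v ((W₁.baseChange (v.adicCompletion ℚ)).a₃ - X.a₃) < WithZero.exp (-(n : ℤ)) →
      Valued.v ((W₁.baseChange (v.adicCompletion ℚ)).a₄ - X.a₄) < WithZero.exp (-(n : ℤ)) →
      Valued.v ((W₁.baseChange (v.adicCompletion ℚ)).a₆ - X.a₆) < WithZero.exp (-(n : ℤ)) →
      Valued.v ((W₂.baseChange (v.adicCompletion ℚ)).a₁ - X.a₁) < WithZero.exp (-(n : ℤ)) →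
      Valued.v ((W₂.baseChange (v.adicCompletion ℚ)).a₂ - X.a₂) < WithZero.exp (-(n : ℤ)) →
      Valued.v ((W₂.baseChange (v.adicCompletion ℚ)).a₃ - X.a₃) < WithZero.exp (-(n : ℤ)) →
      Valued.v ((W₂.baseChange (v.adicCompletion ℚ)).a₄ - X.a₄) < WithZero.exp (-(n : ℤ)) →
      Valued.v ((W₂.baseChange (v.adicCompletion ℚ)).a₆ - X.a₆) < WithZero.exp (-(n : ℤ)) →
      (if natGenerator v ∣ W₁.conductorNorm ℤ then atkinLehnerEigenvalueAt f₁ (natGenerator v)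
        else 1 : ℂ) =
      if natGenerator v ∣ W₂.conductorNorm ℤ then atkinLehnerEigenvalueAt f₂ (natGenerator v)
        else 1 := by
  haveI : IsIntegral (v.adicCompletionIntegers ℚ) X :=
    isIntegral_of_exists_lift _ ⟨⟨_, h₁⟩, rfl⟩ ⟨⟨_, h₂⟩, rfl⟩ ⟨⟨_, h₃⟩, rfl⟩ ⟨⟨_, h₄⟩, rfl⟩
      ⟨⟨_, h₆⟩, rfl⟩
  haveI := hX
  obtain ⟨z, hz0, hz⟩ := localRootNumber_locallyConstant_of_not_hasAdditiveReduction
    (v.adicCompletionIntegers ℚ) X X.isUnit_Δ.ne_zero hadd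
  have hE := isEquiv_valuation_maximalIdeal_of_le_one_iff
    (valued_le_one_iff_mem_range_adicCompletionIntegers (K := ℚ) v)
  obtain ⟨n, hn⟩ := WithZero.exists_exp_neg_natCast_lt
    ((Valuation.ne_zero_iff (Valued.v (R := v.adicCompletion ℚ))).2 hz0)
  -- the data of a rational curve close to `X`
  have key : ∀ (W : WeierstrassCurve ℚ) [W.IsElliptic],
      Valued.v ((W.baseChange (v.adicCompletion ℚ)).a₁ - X.a₁) < WithZero.exp (-(n : ℤ)) →
      Valued.v ((W.baseChange (v.adicCompletion ℚ)).a₂ - X.a₂) < WithZero.exp (-(n : ℤ)) →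
      Valued.v ((W.baseChange (v.adicCompletion ℚ)).a₃ - X.a₃) < WithZero.exp (-(n : ℤ)) →
      Valued.v ((W.baseChange (v.adicCompletion ℚ)).a₄ - X.a₄) < WithZero.exp (-(n : ℤ)) →
      Valued.v ((W.baseChange (v.adicCompletion ℚ)).a₆ - X.a₆) < WithZero.exp (-(n : ℤ)) →
      (W.HasGoodReductionAt v ↔
        (X.minimal (v.adicCompletionIntegers ℚ)).HasGoodReduction (v.adicCompletionIntegers ℚ)) ∧
      ¬ W.HasAdditiveReductionAt v ∧
      W.localRootNumberAt v = X.localRootNumber (v.adicCompletionIntegers ℚ) := by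
    intro W _ k₁ k₂ k₃ k₄ k₆
    obtain ⟨hg, -, -, ha, hw⟩ := hz (W.baseChange (v.adicCompletion ℚ))
      (hE.lt_iff_lt.2 (k₁.trans hn)) (hE.lt_iff_lt.2 (k₂.trans hn)) (hE.lt_iff_lt.2 (k₃.trans hn))
      (hE.lt_iff_lt.2 (k₄.trans hn)) (hE.lt_iff_lt.2 (k₆.trans hn))
    exact ⟨hg, ha, hw⟩
  refine ⟨n, fun W₁ W₂ _ _ _ _ f₁ f₂ hf₁ hf₂ k₁ k₂ k₃ k₄ k₆ l₁ l₂ l₃ l₄ l₆ ↦ ?_⟩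
  obtain ⟨hg₁, ha₁, hw₁⟩ := key W₁ k₁ k₂ k₃ k₄ k₆
  obtain ⟨hg₂, ha₂, hw₂⟩ := key W₂ l₁ l₂ l₃ l₄ l₆
  by_cases hgood : (X.minimal (v.adicCompletionIntegers ℚ)).HasGoodReduction
      (v.adicCompletionIntegers ℚ)
  · -- good reduction: `p ∤ N₁, N₂`
    have hn₁ : ¬ natGenerator v ∣ W₁.conductorNorm ℤ := by
      rw [natGenerator_dvd_conductorNorm_iff v W₁, not_not]; exact hg₁.2 hgood
    have hn₂ : ¬ natGenerator v ∣ W₂.conductorNorm ℤ := by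
      rw [natGenerator_dvd_conductorNorm_iff v W₂, not_not]; exact hg₂.2 hgood
    rw [if_neg hn₁, if_neg hn₂]
  · -- multiplicative reduction: `p ∥ N₁, N₂` and `λ(Q_p)(fᵢ) = w_p(Eᵢ) = w(X)`
    have hd₁ : natGenerator v ∣ W₁.conductorNorm ℤ := by
      rw [natGenerator_dvd_conductorNorm_iff v W₁]; exact fun h ↦ hgood (hg₁.1 h)
    have hd₂ : natGenerator v ∣ W₂.conductorNorm ℤ := by
      rw [natGenerator_dvd_conductorNorm_iff v W₂]; exact fun h ↦ hgood (hg₂.1 h)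
    have hsq₁ : ¬ natGenerator v ^ 2 ∣ W₁.conductorNorm ℤ := by
      rwa [natGenerator_sq_dvd_conductorNorm_iff v W₁]
    have hsq₂ : ¬ natGenerator v ^ 2 ∣ W₂.conductorNorm ℤ := by
      rwa [natGenerator_sq_dvd_conductorNorm_iff v W₂]
    rw [if_pos hd₁, if_pos hd₂]
    have e₁ : atkinLehnerEigenvalueAt f₁ (natGenerator v) = (W₁.localRootNumberAt v : ℂ) := by
      have h := W₁.atkinLehnerEigenvalueAt_eq_localRootNumberAt_of_not_sq_dvd hf₁ (primesEquiv v)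
        hd₁ hsq₁
      rw [Equiv.symm_apply_apply] at h
      exact h
    have e₂ : atkinLehnerEigenvalueAt f₂ (natGenerator v) = (W₂.localRootNumberAt v : ℂ) := by
      have h := W₂.atkinLehnerEigenvalueAt_eq_localRootNumberAt_of_not_sq_dvd hf₂ (primesEquiv v)
        hd₂ hsq₂
      rw [Equiv.symm_apply_apply] at h
      exact h
    rw [e₁, e₂, hw₁, hw₂]


/-! ### The named fact from its residual input at the additive places above `2` and `3` -/

/-- **Helfgott's locally constant local tables from the Modularity Theorem, Kellock–Dokchitser's
Remark 2.2 above `p ≥ 5`, and the `p`-adic local constancy of the Atkin–Lehner sign around the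
equations with additive reduction above `2, 3`.** As
`Helfgott2004_exists_local_tables_locallyConstant_of_residual`, with the local-constancy hypothesis
`hlc` restricted to the `v`-integral elliptic equations `X` over `ℚ_v`, `v ∣ 6`, whose minimal model
has *additive* reduction — Helfgott 2004, Prop. 4.2 (potentially good reduction) and the second
half of the last paragraph of the proof of Prop. 4.3 (additive, potentially multiplicative
reduction) at `K = ℚ₂, ℚ₃`, through `W(E/ℚ_p) = λ(Q_p)(f_E)` (Kellock–Dokchitser Rem. 2.2); at the
semistable equations the local constancy is the theorem
`atkinLehnerSign_locallyConstant_of_not_hasAdditiveReduction`. So the trust base of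
`Helfgott2004_exists_local_tables_locallyConstant` in the tree is {Modularity
(`exists_isNewformOf`), Kellock–Dokchitser Rem. 2.2 above `p ≥ 5`
(`WeierstrassCurve.atkinLehnerEigenvalueAt_eq_localRootNumberAt`), `p`-adic local constancy of
`λ(Q_p)(f_E)` in `E ×_ℚ ℚ_p` around the additive `p`-integral equations, `p ∈ {2, 3}`}.
[cite: Helfgott2004RootNumberFamilies, §4 Prop. 4.2, Prop. 4.3 (proof) and Lemma 4.4]
[cite: KellockDokchitser2023, Def. 2.1, Rem. 2.2 and Thm. 2.3] [cite: Knapp1993, Thm. 9.27]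
[cite: BCDTJAMS2001, Thm. A] -/
theorem Helfgott2004_exists_local_tables_locallyConstant_of_residual_additive
    (hmod : exists_isNewformOf)
    (hF1 : ∀ W : WeierstrassCurve ℚ, W.atkinLehnerEigenvalueAt_eq_localRootNumberAt)
    (hlc : ∀ v : HeightOneSpectrum ℤ, ringChar (ℤ ⧸ v.asIdeal) ≤ 3 →
      ∀ X : WeierstrassCurve (v.adicCompletion ℚ), X.IsElliptic →
        X.a₁ ∈ v.adicCompletionIntegers ℚ → X.a₂ ∈ v.adicCompletionIntegers ℚ →
        X.a₃ ∈ v.adicCompletionIntegers ℚ → X.a₄ ∈ v.adicCompletionIntegers ℚ →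
        X.a₆ ∈ v.adicCompletionIntegers ℚ →
        (X.minimal (v.adicCompletionIntegers ℚ)).HasAdditiveReduction (v.adicCompletionIntegers ℚ) →
        ∃ n : ℕ, ∀ (W₁ W₂ : WeierstrassCurve ℚ) [W₁.IsElliptic] [W₂.IsElliptic]
          [NeZero (W₁.conductorNorm ℤ)] [NeZero (W₂.conductorNorm ℤ)]
          (f₁ : CuspForm (Gamma0 (W₁.conductorNorm ℤ)) 2)
          (f₂ : CuspForm (Gamma0 (W₂.conductorNorm ℤ)) 2), IsNewformOf W₁ f₁ → IsNewformOf W₂ f₂ →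
          Valued.v ((W₁.baseChange (v.adicCompletion ℚ)).a₁ - X.a₁) < WithZero.exp (-(n : ℤ)) →
          Valued.v ((W₁.baseChange (v.adicCompletion ℚ)).a₂ - X.a₂) < WithZero.exp (-(n : ℤ)) →
          Valued.v ((W₁.baseChange (v.adicCompletion ℚ)).a₃ - X.a₃) < WithZero.exp (-(n : ℤ)) →
          Valued.v ((W₁.baseChange (v.adicCompletion ℚ)).a₄ - X.a₄) < WithZero.exp (-(n : ℤ)) →
          Valued.v ((W₁.baseChange (v.adicCompletion ℚ)).a₆ - X.a₆) < WithZero.exp (-(n : ℤ)) →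
          Valued.v ((W₂.baseChange (v.adicCompletion ℚ)).a₁ - X.a₁) < WithZero.exp (-(n : ℤ)) →
          Valued.v ((W₂.baseChange (v.adicCompletion ℚ)).a₂ - X.a₂) < WithZero.exp (-(n : ℤ)) →
          Valued.v ((W₂.baseChange (v.adicCompletion ℚ)).a₃ - X.a₃) < WithZero.exp (-(n : ℤ)) →
          Valued.v ((W₂.baseChange (v.adicCompletion ℚ)).a₄ - X.a₄) < WithZero.exp (-(n : ℤ)) →
          Valued.v ((W₂.baseChange (v.adicCompletion ℚ)).a₆ - X.a₆) < WithZero.exp (-(n : ℤ)) →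
          (if natGenerator v ∣ W₁.conductorNorm ℤ then atkinLehnerEigenvalueAt f₁ (natGenerator v)
            else 1 : ℂ) =
          if natGenerator v ∣ W₂.conductorNorm ℤ then atkinLehnerEigenvalueAt f₂ (natGenerator v)
            else 1) :
    Helfgott2004_exists_local_tables_locallyConstant :=
  Helfgott2004_exists_local_tables_locallyConstant_of_residual hmod hF1
    fun v hv X hX h₁ h₂ h₃ h₄ h₆ ↦ by
      by_cases hadd : (X.minimal (v.adicCompletionIntegers ℚ)).HasAdditiveReduction
          (v.adicCompletionIntegers ℚ)
      · exact hlc v hv X hX h₁ h₂ h₃ h₄ h₆ hadd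
      · exact atkinLehnerSign_locallyConstant_of_not_hasAdditiveReduction X hX h₁ h₂ h₃ h₄ h₆ hadd

/-- `exists_local_tables_two_three` from the same three inputs as
`Helfgott2004_exists_local_tables_locallyConstant_of_residual_additive` (through
`exists_local_tables_two_three_of_locallyConstant`).
[cite: Helfgott2004RootNumberFamilies, §4 Lemma 4.4]
[cite: KellockDokchitser2023, Def. 2.1, Rem. 2.2 and Thm. 2.3] -/
theorem exists_local_tables_two_three_of_locallyConstant_residual_additive
    (hmod : exists_isNewformOf)
    (hF1 : ∀ W : WeierstrassCurve ℚ, W.atkinLehnerEigenvalueAt_eq_localRootNumberAt)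
    (hlc : ∀ v : HeightOneSpectrum ℤ, ringChar (ℤ ⧸ v.asIdeal) ≤ 3 →
      ∀ X : WeierstrassCurve (v.adicCompletion ℚ), X.IsElliptic →
        X.a₁ ∈ v.adicCompletionIntegers ℚ → X.a₂ ∈ v.adicCompletionIntegers ℚ →
        X.a₃ ∈ v.adicCompletionIntegers ℚ → X.a₄ ∈ v.adicCompletionIntegers ℚ →
        X.a₆ ∈ v.adicCompletionIntegers ℚ →
        (X.minimal (v.adicCompletionIntegers ℚ)).HasAdditiveReduction (v.adicCompletionIntegers ℚ) →
        ∃ n : ℕ, ∀ (W₁ W₂ : WeierstrassCurve ℚ) [W₁.IsElliptic] [W₂.IsElliptic]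
          [NeZero (W₁.conductorNorm ℤ)] [NeZero (W₂.conductorNorm ℤ)]
          (f₁ : CuspForm (Gamma0 (W₁.conductorNorm ℤ)) 2)
          (f₂ : CuspForm (Gamma0 (W₂.conductorNorm ℤ)) 2), IsNewformOf W₁ f₁ → IsNewformOf W₂ f₂ →
          Valued.v ((W₁.baseChange (v.adicCompletion ℚ)).a₁ - X.a₁) < WithZero.exp (-(n : ℤ)) →
          Valued.v ((W₁.baseChange (v.adicCompletion ℚ)).a₂ - X.a₂) < WithZero.exp (-(n : ℤ)) →
          Valued.v ((W₁.baseChange (v.adicCompletion ℚ)).a₃ - X.a₃) < WithZero.exp (-(n : ℤ)) →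
          Valued.v ((W₁.baseChange (v.adicCompletion ℚ)).a₄ - X.a₄) < WithZero.exp (-(n : ℤ)) →
          Valued.v ((W₁.baseChange (v.adicCompletion ℚ)).a₆ - X.a₆) < WithZero.exp (-(n : ℤ)) →
          Valued.v ((W₂.baseChange (v.adicCompletion ℚ)).a₁ - X.a₁) < WithZero.exp (-(n : ℤ)) →
          Valued.v ((W₂.baseChange (v.adicCompletion ℚ)).a₂ - X.a₂) < WithZero.exp (-(n : ℤ)) →
          Valued.v ((W₂.baseChange (v.adicCompletion ℚ)).a₃ - X.a₃) < WithZero.exp (-(n : ℤ)) →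
          Valued.v ((W₂.baseChange (v.adicCompletion ℚ)).a₄ - X.a₄) < WithZero.exp (-(n : ℤ)) →
          Valued.v ((W₂.baseChange (v.adicCompletion ℚ)).a₆ - X.a₆) < WithZero.exp (-(n : ℤ)) →
          (if natGenerator v ∣ W₁.conductorNorm ℤ then atkinLehnerEigenvalueAt f₁ (natGenerator v)
            else 1 : ℂ) =
          if natGenerator v ∣ W₂.conductorNorm ℤ then atkinLehnerEigenvalueAt f₂ (natGenerator v)
            else 1) :
    exists_local_tables_two_three :=
  exists_local_tables_two_three_of_locallyConstant
    (Helfgott2004_exists_local_tables_locallyConstant_of_residual_additive hmod hF1 hlc)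

end Literature.NumberTheory.EllipticCurves


end
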